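import Summits.NavierStokesRegularity.NavierStokesRegularity.Theses.RellichScar
import Summits.NavierStokesRegularity.NavierStokesRegularity.Theorems.ScarRigidity.Negative.LogicAndLoadBearing
import Summits.NavierStokesRegularity.NavierStokesRegularity.Theorems.RellichScarScarRigidityApexMild
import Literature.Analysis.FluidPDE.TypeIAncientMild
import HarnessLib

/-!
# `ScarRigidity` — line `moment-conditioned-rellich` (crux stmt-NavierStokesRegularity-11717, route RellichScar)

SKELETON of the SECOND line lead (prover-line-stmt-NavierStokesRegularity-11717-b-0), rebuilt from the
planner's registered stub signatures (archive ids 8451: `stub_paintedLadder` / `stub_quadrupoleDefectVanishes` /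
`stub_higherMomentsVanish` / `stub_flatScarRigidity`; the planner's `Lines/moment-conditioned-rellich.lean` is not
mounted in this jail) and RESHAPED onto smooth representatives:

* the regularity layer is SHARED with line `finite-energy-log-convexity` (lead 1): `stub_apexMildRepresentative`
  (S1α, LANDED as `Theorems/RellichScarScarRigidityApexMild.lean`, imported) gives every apex-class profile a
  Type-I ancient mild representative `V` with the apex bound; `stub_apexRegularity` below is the ALL-ORDERS
  scale-invariant bound package with a Leray-gauge pressure `Q` (lead 1's `stub_apexDerivativeBounds` is its
  order-≤-2 truncation; the painted ladder needs every order because each rung differentiates the previous one);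
* `stub_farFieldAllOrders` (elementary): same scar + the package ⇒ the twins and ALL their spatial derivatives are
  `O((−t)‖x‖^{−3−k})` on the parabolic exterior `√(−t) ≤ ‖x‖` (`FarDecay 3`): uniform limits of derivatives off
  the apex vanish at the final slice, then one integrates `∂ₜ∇ᵏ(V₁−V₂)`;
* `stub_paintedLadder` (XL, provable in principle): rung `ℓ ≥ 1` — if the radiative moments `Q_{ℓ'}[H]` of the
  Reynolds-stress defect `V₁⊗V₁ − V₂⊗V₂` against all solid harmonics `H` of degrees `2 ≤ ℓ' ≤ ℓ` vanish, the
  pressure-painted tail is absent to that order and `V₁ − V₂ = O((−t)^{(ℓ+2)/2}‖x‖^{−ℓ−3})` with all derivatives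
  (`FarDecay (ℓ+3)`); `ℓ = 1` is unconditional (momentum of the pair is conserved and vanishes at `t = 0⁻`);
* `stub_quadrupoleDefectVanishes` (OPEN, the load-bearing rung, held by the lead): `Q₂^{tf}(t) = 0` for `t < 0`;
* `stub_higherMomentsVanish` (OPEN): the rungs `ℓ ≥ 3`, each stated under the absolute convergence the previous
  rung supplies (`FarDecay (ℓ+2)`);
* `stub_flatScarRigidity` (XL/open: unique continuation from spatial infinity for the exact difference system
  across the critical core): a pair flat to ALL orders on the parabolic exterior coincides.

Composition `ScarRigidity_of`: normal form `scarRigidity_iff_pos` (only `0 < C` carries content), representatives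
(S1α), package, a.e.-transfer of the scar and of the singular apex to the representatives (proved here), far field,
the ladder by induction on the order (`allOrders_of_ladder`, proved here), flat rigidity, transfer back.  Disproof
honoured: every analytic stub keeps BOTH Navier–Stokes systems on the WHOLE open slab with the spatial apex decay
((A⁺)(B⁺)(B)(C)(C″)(D) of `Cruxes/ScarRigidity/Disproof.lean`), nothing is exterior-only or local (the painted ladder
is an exterior CONCLUSION drawn from whole-space hypotheses, cf. §5(iii): its first rung uses the equations of
`V₁, V₂`, not the difference inequality); §7/§9 (no size-based estimate above threshold) bear on
`stub_flatScarRigidity` and the two rungs, which are stated for the EXACT pair, not for an inequality.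
-/

noncomputable section

open Set Filter Function MeasureTheory Metric TopologicalSpace
open scoped Topology ENNReal NNReal InnerProductSpace RealInnerProductSpace Laplacian
open Literature.Analysis.FluidPDE
open Summit.NavierStokesRegularity.NavierStokesRegularity.Theses.RellichScar
open Summit.NavierStokesRegularity.NavierStokesRegularity.Theorems.ScarRigidity.Negative

set_option linter.dupNamespace false

namespace Summit.NavierStokesRegularity.NavierStokesRegularity.Theorems.RellichScarScarRigidity

/-- Physical space. -/
local notation "ℝ³" => EuclideanSpace ℝ (Fin 3)

/-- The open backward slab `(-∞,0) × ℝ³` (time first), as in the route file. -/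
local notation "𝕊" => Literature.Analysis.FluidPDE.slab (EuclideanSpace ℝ (Fin 3)) (Set.Iio (0 : ℝ)) isOpen_Iio

/-! ## Line vocabulary (inline in every stub signature; no new definitions are registered) -/

/-! ### Notational reading of the recurring sub-formulas

* SCALE-INVARIANT PACKAGE of a classical pair `(V, Q)` on the open slab (all SPATIAL orders, first time derivative):
  `∀ n, ∃ L, ∀ t < 0, ∀ x, ‖∇ⁿ V (t,x)‖ ≤ L/(‖x‖+√(−t))^{1+n}`, `‖∇ⁿ Q (t,x)‖ ≤ L/(‖x‖+√(−t))^{2+n}` and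
  `‖∂ₜ ∇ⁿ V (t,x)‖ ≤ L/(‖x‖+√(−t))^{3+n}` (the last written with `deriv (fun s => iteratedFDeriv ℝ n (V s) x) t`).
  Higher TIME derivatives are deliberately absent: the Leray-gauge pressure of a Type-I profile carries the
  core-fed quadrupole `√(−t) q(t):∇²(1/‖x‖)` in its far field, so `∂ₜQ ~ (−t)^{−1/2}‖x‖⁻³` and `∂ₜ²V ~ (−t)^{−1/2}‖x‖⁻⁴`
  are NOT `O(‖x‖⁻⁴)`, `O(‖x‖⁻⁵)`; the ladder only ever integrates FIRST time derivatives back from the final slice.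
* `FarDecay N` of a pair `(V₁, V₂)` (flatness of order `N` on the parabolic exterior, all derivatives):
  `∀ k, ∃ K, ∀ t < 0, ∀ x, √(−t) ≤ ‖x‖ → ‖∇ᵏ(V₁(t) − V₂(t))(x)‖ ≤ K (√(−t))⁻¹ (√(−t)/‖x‖)^N / ‖x‖^k`.
* RADIATIVE MOMENT of degree `ℓ` against a solid harmonic `H` (smooth, positively homogeneous of degree `ℓ`,
  `ΔH = 0`): `Q_ℓ[H](t) = ∫ Σᵢⱼ ((V₁)ᵢ(V₁)ⱼ − (V₂)ᵢ(V₂)ⱼ)(t,x) ∂ᵢ∂ⱼH(x) dx`; "the moments of degree `ℓ` vanish"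
  means: for every such `H` and every `t < 0` the integrand is integrable and the integral is `0`
  (for `ℓ = 2` this is the trace-free part of `∫ (V₁⊗V₁ − V₂⊗V₂)`, five functions of `t`). -/

/-- Flatness of order `N` of the pair `(V₁, V₂)` on the parabolic exterior, with all spatial derivatives. -/
def FarDecay (N : ℕ) (V₁ V₂ : ℝ → ℝ³ → ℝ³) : Prop :=
  ∀ k : ℕ, ∃ K : ℝ, ∀ t < 0, ∀ x : ℝ³, Real.sqrt (-t) ≤ ‖x‖ →
    ‖iteratedFDeriv ℝ k (fun y => V₁ t y - V₂ t y) x‖ ≤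
      K * (Real.sqrt (-t))⁻¹ * (Real.sqrt (-t) / ‖x‖) ^ N / ‖x‖ ^ k

/-- Solid harmonics of degree `ℓ`: smooth, positively homogeneous of degree `ℓ`, harmonic. -/
def IsSolidHarmonic (ℓ : ℕ) (H : ℝ³ → ℝ) : Prop :=
  ContDiff ℝ (⊤ : ℕ∞) H ∧ (∀ (r : ℝ) (x : ℝ³), 0 < r → H (r • x) = r ^ ℓ * H x) ∧ ∀ x, (Δ H) x = 0

/-- The integrand of the radiative moment of the Reynolds-stress defect against `H` at time `t`. -/
def momentIntegrand (H : ℝ³ → ℝ) (V₁ V₂ : ℝ → ℝ³ → ℝ³) (t : ℝ) (x : ℝ³) : ℝ :=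
  ∑ i : Fin 3, ∑ j : Fin 3,
    ((V₁ t x) i * (V₁ t x) j - (V₂ t x) i * (V₂ t x) j) *
      iteratedFDeriv ℝ 2 H x ![EuclideanSpace.single i (1 : ℝ), EuclideanSpace.single j (1 : ℝ)]

/-- The radiative moments of degree `ℓ` of the pair vanish at every negative time. -/
def RadiativeMomentsVanish (ℓ : ℕ) (V₁ V₂ : ℝ → ℝ³ → ℝ³) : Prop :=
  ∀ H : ℝ³ → ℝ, IsSolidHarmonic ℓ H → ∀ t < 0,
    Integrable (momentIntegrand H V₁ V₂ t) volume ∧ ∫ x, momentIntegrand H V₁ V₂ t x = 0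

/-- The scale-invariant bound package of a velocity/pressure pair on the open slab: all spatial derivatives of
`V` and `Q`, and the first time derivative of every spatial derivative of `V`. -/
def ScaleInvariantBounds (V : ℝ → ℝ³ → ℝ³) (Q : ℝ → ℝ³ → ℝ) : Prop :=
  ∀ n : ℕ, ∃ L : ℝ, ∀ t < 0, ∀ x : ℝ³,
    ‖iteratedFDeriv ℝ n (V t) x‖ ≤ L / (‖x‖ + Real.sqrt (-t)) ^ (1 + n) ∧
      ‖iteratedFDeriv ℝ n (Q t) x‖ ≤ L / (‖x‖ + Real.sqrt (-t)) ^ (2 + n) ∧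
        ‖deriv (fun s => iteratedFDeriv ℝ n (V s) x) t‖ ≤ L / (‖x‖ + Real.sqrt (-t)) ^ (3 + n)

/-! ## The stubs -/

/-- **S-reg — all-orders scale-invariant bounds for Type-I ancient mild apex profiles (single profile).**
A Type-I ancient mild field (Oseen/KNSS gauge) with the apex bound `‖V‖ ≤ C/(‖x‖+√(−t))` is a classical
Navier–Stokes solution on the open slab with a Leray-gauge pressure `Q`, with the scale-invariant bounds
`‖∇ⁿV‖ ≤ L/(‖x‖+√(−t))^{1+n}`, `‖∇ⁿQ‖ ≤ L/(‖x‖+√(−t))^{2+n}`, `‖∂ₜ∇ⁿV‖ ≤ L/(‖x‖+√(−t))^{3+n}` for every `n`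
(the third follows from the first two through the differentiated momentum equation).
Sources: KNSS 2009 Prop. 4.1 / §6 (bounded ancient mild solutions have all derivatives bounded at the
parabolic scale), local higher regularity of bounded suitable solutions at scale `‖x‖` (Seregin 2014 Ch. 6;
tree `NSBoundedHigherRegularityBounds_holds`, `KNSSMildRegularity*`), pressure `Q = ℛℛ(V⊗V)` by off-diagonal
Calderón–Zygmund bounds.  Lead 1's `stub_apexDerivativeBounds` is the truncation `n ≤ 2` / `n ≤ 1`. -/
theorem stub_apexRegularity :
    ∀ (V : ℝ → ℝ³ → ℝ³) (C : ℝ), 0 < C → IsTypeIAncientMild C V → HasTypeIDecay C V →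
      ∃ Q : ℝ → ℝ³ → ℝ, IsClassicalNSSolutionOn (Iio (0 : ℝ)) 1 0 V Q ∧ ScaleInvariantBounds V Q := by
  sorry

/-- **S-far — the scar makes the twins cubically flat on the parabolic exterior, with all derivatives.**
For two classical pairs with the scale-invariant package and the SAME SCAR, every spatial derivative of
`V₁ − V₂` is `O((−t)‖x‖^{−3−k})` on `√(−t) ≤ ‖x‖`: the derivatives `∇ᵏ(V₁−V₂)(t,·)` converge locally
uniformly off the apex as `t ↑ 0` (their time derivatives are bounded by `2L/‖x‖^{3+k}`), the limit of
`V₁ − V₂` is `0` by the scar, limits of derivatives are derivatives of the limit, and one integrates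
`∂ₜ∇ᵏ(V₁−V₂)` back from the final slice. [folklore] -/
theorem stub_farFieldAllOrders :
    ∀ (V₁ V₂ : ℝ → ℝ³ → ℝ³) (Q₁ Q₂ : ℝ → ℝ³ → ℝ),
      IsClassicalNSSolutionOn (Iio (0 : ℝ)) 1 0 V₁ Q₁ → IsClassicalNSSolutionOn (Iio (0 : ℝ)) 1 0 V₂ Q₂ →
      ScaleInvariantBounds V₁ Q₁ → ScaleInvariantBounds V₂ Q₂ → SameScar V₁ V₂ →
      FarDecay 3 V₁ V₂ := by
  sorry

/-- **PL — the painted ladder (rung `ℓ ≥ 1`).**  Two classical Navier–Stokes pairs on the open slab with the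
apex bound at the same constant, the scale-invariant package and cubic flatness (`FarDecay 3`, the scar) whose
radiative moments of degrees `2 ≤ ℓ' ≤ ℓ` vanish are flat of order `ℓ + 3`:
`∇ᵏ(V₁ − V₂) = O((−t)^{(ℓ+2)/2}‖x‖^{−ℓ−3−k})` on `√(−t) ≤ ‖x‖`.  Mechanism: `w = V₁ − V₂` vanishes with all
derivatives at the final slice off the apex, `∂ₜw = −∇π + (Δw − ∇·(V₁⊗w + w⊗V₂))`, the bracket is one order
better by the previous rung, and the far field of `∇π`, `π = ℛᵢℛⱼ(V₁⊗w + w⊗V₂)ᵢⱼ`, is the multipole series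
whose coefficient at order `‖x‖^{−ℓ'−2}` is `Q_{ℓ'}[H]`; `ℓ' = 0, 1` carry `∇²H = 0`.  Sources: card
moment-conditioned-rellich (lever, (ii)); KNSS 2009; Stein, *Singular Integrals* III §3 (far-field expansion of
Newtonian potentials). -/
theorem stub_paintedLadder :
    ∀ (V₁ V₂ : ℝ → ℝ³ → ℝ³) (Q₁ Q₂ : ℝ → ℝ³ → ℝ) (C : ℝ) (ℓ : ℕ), 0 < C → 1 ≤ ℓ →
      IsClassicalNSSolutionOn (Iio (0 : ℝ)) 1 0 V₁ Q₁ → IsClassicalNSSolutionOn (Iio (0 : ℝ)) 1 0 V₂ Q₂ →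
      HasTypeIDecay C V₁ → HasTypeIDecay C V₂ →
      ScaleInvariantBounds V₁ Q₁ → ScaleInvariantBounds V₂ Q₂ → FarDecay 3 V₁ V₂ →
      (∀ ℓ' : ℕ, 2 ≤ ℓ' → ℓ' ≤ ℓ → RadiativeMomentsVanish ℓ' V₁ V₂) →
      FarDecay (ℓ + 3) V₁ V₂ := by
  sorry

/-- **Q2 — THE QUADRUPOLE DEFECT VANISHES (OPEN; the load-bearing rung, held by the lead).**  For two Type-I
ancient mild apex profiles at the same constant, classical with the scale-invariant package, both singular at the
space–time origin, with the same scar in its quartic form `FarDecay 4` (rung `ℓ = 1`), the trace-free Reynolds-stress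
defect `Q₂^{tf}(t) = tf ∫ (V₁⊗V₁ − V₂⊗V₂)(t) dx` vanishes for every `t < 0` (absolutely convergent by `FarDecay 4`).
No mechanism is known: the pair identities available (momentum `ℓ = 1`, angular momentum, energy defect = trace
part, tensor virial `Ḋ = Q₂^{tf} + …` which only slaves the stresslet `D`) leave the five functions `Q₂^{tf}`
free (TRIAGE r1-2 (F1)); a proof must use the profile equations across the core (Disproof §7, §9). -/
theorem stub_quadrupoleDefectVanishes :
    ∀ (V₁ V₂ : ℝ → ℝ³ → ℝ³) (Q₁ Q₂ : ℝ → ℝ³ → ℝ) (C : ℝ), 0 < C →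
      IsTypeIAncientMild C V₁ → IsTypeIAncientMild C V₂ → HasTypeIDecay C V₁ → HasTypeIDecay C V₂ →
      IsClassicalNSSolutionOn (Iio (0 : ℝ)) 1 0 V₁ Q₁ → IsClassicalNSSolutionOn (Iio (0 : ℝ)) 1 0 V₂ Q₂ →
      ScaleInvariantBounds V₁ Q₁ → ScaleInvariantBounds V₂ Q₂ →
      IsBackwardSingularPoint V₁ 0 → IsBackwardSingularPoint V₂ 0 →
      FarDecay 4 V₁ V₂ → RadiativeMomentsVanish 2 V₁ V₂ := by
  sorry

/-- **HM — THE HIGHER RADIATIVE MOMENTS VANISH (OPEN; rungs `ℓ ≥ 3`).**  Same setting; if the pair is already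
flat of order `ℓ + 2` (so that the degree-`ℓ` moments converge absolutely: `‖x‖^{ℓ−2}·‖x‖⁻¹·‖x‖^{−ℓ−2} = ‖x‖⁻⁵`),
then the radiative moments of degree `ℓ` vanish.  No mechanism is known (the only conserved moments are `ℓ ≤ 1`). -/
theorem stub_higherMomentsVanish :
    ∀ (V₁ V₂ : ℝ → ℝ³ → ℝ³) (Q₁ Q₂ : ℝ → ℝ³ → ℝ) (C : ℝ) (ℓ : ℕ), 0 < C → 3 ≤ ℓ →
      IsTypeIAncientMild C V₁ → IsTypeIAncientMild C V₂ → HasTypeIDecay C V₁ → HasTypeIDecay C V₂ →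
      IsClassicalNSSolutionOn (Iio (0 : ℝ)) 1 0 V₁ Q₁ → IsClassicalNSSolutionOn (Iio (0 : ℝ)) 1 0 V₂ Q₂ →
      ScaleInvariantBounds V₁ Q₁ → ScaleInvariantBounds V₂ Q₂ →
      IsBackwardSingularPoint V₁ 0 → IsBackwardSingularPoint V₂ 0 →
      FarDecay (ℓ + 2) V₁ V₂ → RadiativeMomentsVanish ℓ V₁ V₂ := by
  sorry

/-- **FSR — FLAT SCAR RIGIDITY (XL; step (B) of the line).**  Two Type-I ancient mild apex profiles at the same
constant, classical with the scale-invariant package, both singular at the origin, which are flat to EVERY order on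
the parabolic exterior (`∀ N, FarDecay N`: in Leray variables `W = U₁ − U₂ = O(|y|^{−N})` for all `N`, uniformly in
`s`) coincide on the open slab.  Intended mechanism: Carleman estimate from spatial infinity with power weights for
the exact difference system `∂ₛW = (Δ − ½y·∇ − ½)W − Ū·∇W − W·∇Ū − ∇Π` (the outward drift conjugates `|y|^τ` to a
coercive `+τ/2`), then unique continuation at regular times.  Disproof §5(ii)/§7: false at any FIXED order and for
size-only coefficients; the statement here is for the exact pair and all orders.  Sources: card (B);
Lin–Uhlmann–Wang 2011 (steady exterior template); Escauriaza–Seregin–Šverák 2003; Fabre–Lebeau 1996. -/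
theorem stub_flatScarRigidity :
    ∀ (V₁ V₂ : ℝ → ℝ³ → ℝ³) (Q₁ Q₂ : ℝ → ℝ³ → ℝ) (C : ℝ), 0 < C →
      IsTypeIAncientMild C V₁ → IsTypeIAncientMild C V₂ → HasTypeIDecay C V₁ → HasTypeIDecay C V₂ →
      IsClassicalNSSolutionOn (Iio (0 : ℝ)) 1 0 V₁ Q₁ → IsClassicalNSSolutionOn (Iio (0 : ℝ)) 1 0 V₂ Q₂ →
      ScaleInvariantBounds V₁ Q₁ → ScaleInvariantBounds V₂ Q₂ →
      IsBackwardSingularPoint V₁ 0 → IsBackwardSingularPoint V₂ 0 →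
      (∀ N : ℕ, FarDecay N V₁ V₂) → ∀ t < 0, ∀ x : ℝ³, V₁ t x = V₂ t x := by
  sorry

/-! ## Composition (sorry-free) -/

/-- `FarDecay` is antitone in the order: on `√(−t) ≤ ‖x‖` the ratio `√(−t)/‖x‖` is at most `1`. [folklore] -/
theorem farDecay_anti {N N' : ℕ} (h : N' ≤ N) {V₁ V₂ : ℝ → ℝ³ → ℝ³} (hN : FarDecay N V₁ V₂) :
    FarDecay N' V₁ V₂ := by
  intro k
  obtain ⟨K, hK⟩ := hN k
  refine ⟨max K 0, fun t ht x hx => ?_⟩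
  have hst : 0 < Real.sqrt (-t) := Real.sqrt_pos.2 (by linarith)
  have hxpos : 0 < ‖x‖ := hst.trans_le hx
  have hq0 : 0 ≤ Real.sqrt (-t) / ‖x‖ := div_nonneg hst.le hxpos.le
  have hq1 : Real.sqrt (-t) / ‖x‖ ≤ 1 := (div_le_one hxpos).2 hx
  have hpow : (Real.sqrt (-t) / ‖x‖) ^ N ≤ (Real.sqrt (-t) / ‖x‖) ^ N' :=
    pow_le_pow_of_le_one hq0 hq1 h
  have hinv : 0 ≤ (Real.sqrt (-t))⁻¹ := inv_nonneg.2 hst.le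
  have hxk : 0 < ‖x‖ ^ k := pow_pos hxpos k
  calc ‖iteratedFDeriv ℝ k (fun y => V₁ t y - V₂ t y) x‖
      ≤ K * (Real.sqrt (-t))⁻¹ * (Real.sqrt (-t) / ‖x‖) ^ N / ‖x‖ ^ k := hK t ht x hx
    _ ≤ max K 0 * (Real.sqrt (-t))⁻¹ * (Real.sqrt (-t) / ‖x‖) ^ N / ‖x‖ ^ k := by
        refine div_le_div_of_nonneg_right ?_ hxk.le
        exact mul_le_mul_of_nonneg_right (mul_le_mul_of_nonneg_right (le_max_left _ _) hinv)
          (pow_nonneg hq0 _)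
    _ ≤ max K 0 * (Real.sqrt (-t))⁻¹ * (Real.sqrt (-t) / ‖x‖) ^ N' / ‖x‖ ^ k := by
        refine div_le_div_of_nonneg_right ?_ hxk.le
        exact mul_le_mul_of_nonneg_left hpow (mul_nonneg (le_max_right _ _) hinv)

/-- **The ladder closes by induction on the order**: rung `ℓ = 1` of PL gives `FarDecay 4`, Q2 the degree-2
moments, and alternately PL (flatness one order up) / HM (the next moments); hence flatness of every order. -/
theorem allOrders_of_ladder {V₁ V₂ : ℝ → ℝ³ → ℝ³}
    (hPL : ∀ ℓ : ℕ, 1 ≤ ℓ → (∀ ℓ' : ℕ, 2 ≤ ℓ' → ℓ' ≤ ℓ → RadiativeMomentsVanish ℓ' V₁ V₂) →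
      FarDecay (ℓ + 3) V₁ V₂)
    (hQ2 : FarDecay 4 V₁ V₂ → RadiativeMomentsVanish 2 V₁ V₂)
    (hHM : ∀ ℓ : ℕ, 3 ≤ ℓ → FarDecay (ℓ + 2) V₁ V₂ → RadiativeMomentsVanish ℓ V₁ V₂) :
    ∀ N : ℕ, FarDecay N V₁ V₂ := by
  -- all moments of degree `2 ≤ ℓ' ≤ ℓ` vanish, for every `ℓ`
  have hmom : ∀ ℓ : ℕ, ∀ ℓ' : ℕ, 2 ≤ ℓ' → ℓ' ≤ ℓ → RadiativeMomentsVanish ℓ' V₁ V₂ := by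
    intro ℓ
    induction ℓ with
    | zero => intro ℓ' h2 h0; omega
    | succ n ih =>
      intro ℓ' h2 hle
      rcases Nat.lt_or_ge ℓ' (n + 1) with hlt | hge
      · exact ih ℓ' h2 (by omega)
      · have heq : ℓ' = n + 1 := le_antisymm hle hge
        subst heq
        -- flatness of order `n + 3` from the rungs up to `n` (or rung 1 when `n ≤ 1`)
        rcases Nat.lt_or_ge n 2 with hn | hn
        · -- `n + 1 = 2`: the quadrupole
          have h1 : n = 1 := by omega
          subst h1
          refine hQ2 ?_
          exact hPL 1 le_rfl (fun ℓ' h2' h1' => by omega)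
        · have hF : FarDecay (n + 3) V₁ V₂ := hPL n (by omega) ih
          exact hHM (n + 1) (by omega) (by simpa [add_assoc, add_comm, add_left_comm] using hF)
  intro N
  have hF : FarDecay (max N 1 + 3) V₁ V₂ := hPL (max N 1) (le_max_right _ _) (hmom _)
  exact farDecay_anti (by omega) hF

/-- A.e.-equal fields on the slab have the same scar relation (the scar is an `ess sup` statement on subsets
of the slab). [folklore] -/
theorem sameScar_congr_ae {u₁ u₂ V₁ V₂ : ℝ → ℝ³ → ℝ³}
    (h₁ : uncurry V₁ =ᵐ[volume.restrict (Iio (0 : ℝ) ×ˢ (univ : Set ℝ³))] uncurry u₁)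
    (h₂ : uncurry V₂ =ᵐ[volume.restrict (Iio (0 : ℝ) ×ˢ (univ : Set ℝ³))] uncurry u₂)
    (h : SameScar u₁ u₂) : SameScar V₁ V₂ := by
  intro K hK h0
  refine (h K hK h0).congr' ?_
  filter_upwards [self_mem_nhdsWithin] with δ _
  have hsub : Ioo (-δ) 0 ×ˢ K ⊆ Iio (0 : ℝ) ×ˢ (univ : Set ℝ³) := fun z hz => ⟨hz.1.2, trivial⟩
  have h₁' := ae_restrict_of_ae_restrict_of_subset hsub h₁
  have h₂' := ae_restrict_of_ae_restrict_of_subset hsub h₂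
  refine eLpNorm_congr_ae ?_
  filter_upwards [h₁', h₂'] with z hz₁ hz₂
  simp only [Pi.sub_apply, hz₁, hz₂]

/-- A.e.-equal fields on the slab have the same backward-singular behaviour at the origin (the backward cylinders
`Q_r(0,0)` lie in the slab). [folklore] -/
theorem isBackwardSingularPoint_congr_ae {u V : ℝ → ℝ³ → ℝ³}
    (hV : uncurry V =ᵐ[volume.restrict (Iio (0 : ℝ) ×ˢ (univ : Set ℝ³))] uncurry u)
    (hs : IsBackwardSingularPoint u 0) : IsBackwardSingularPoint V 0 := by
  intro r hr
  have hsub : parabolicCylinder r (0 : ℝ × ℝ³) ⊆ Iio (0 : ℝ) ×ˢ (univ : Set ℝ³) := by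
    intro z hz
    rw [mem_parabolicCylinder] at hz
    exact ⟨by simpa using hz.1.2, trivial⟩
  have hae := ae_restrict_of_ae_restrict_of_subset hsub hV
  rw [eLpNorm_congr_ae hae]
  exact hs r hr

/-- A pointwise statement on `t < 0` holds a.e. on the slab `Iio 0 ×ˢ univ`. [folklore] -/
theorem ae_slab_of_forall' {P : ℝ × ℝ³ → Prop} (h : ∀ t < 0, ∀ x : ℝ³, P (t, x)) :
    ∀ᵐ z ∂(volume.restrict (Iio (0 : ℝ) ×ˢ (univ : Set ℝ³))), P z := by
  filter_upwards [ae_restrict_mem (measurableSet_Iio.prod MeasurableSet.univ)] with z hz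
  exact h z.1 (mem_prod.1 hz).1 z.2

/-- **The line closes the crux modulo its stubs**: `ScarRigidity` from S1α (landed), S-reg, S-far, PL, Q2, HM and
FSR, via the normal form `scarRigidity_iff_pos` (only `0 < C` carries content). -/
theorem ScarRigidity_of : ScarRigidity := by
  rw [scarRigidity_iff_pos]
  intro C hC u₁ p₁ G₁ u₂ p₂ G₂ hs₁ hg₁ hI₁ hd₁ hs₂ hg₂ hI₂ hd₂ hsing₁ hsing₂ hscar
  -- smooth Type-I ancient mild representatives (S1α, lead 1, landed)
  obtain ⟨V₁, hae₁, hm₁, hdV₁⟩ := stub_apexMildRepresentative u₁ p₁ G₁ C hC hs₁ hg₁ hI₁ hd₁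
  obtain ⟨V₂, hae₂, hm₂, hdV₂⟩ := stub_apexMildRepresentative u₂ p₂ G₂ C hC hs₂ hg₂ hI₂ hd₂
  -- pressures and the all-orders package
  obtain ⟨Q₁, hcl₁, hB₁⟩ := stub_apexRegularity V₁ C hC hm₁ hdV₁
  obtain ⟨Q₂, hcl₂, hB₂⟩ := stub_apexRegularity V₂ C hC hm₂ hdV₂
  -- the scar and the singular apex pass to the representatives
  have hscarV : SameScar V₁ V₂ := sameScar_congr_ae hae₁ hae₂ hscar
  have hsV₁ : IsBackwardSingularPoint V₁ 0 := isBackwardSingularPoint_congr_ae hae₁ hsing₁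
  have hsV₂ : IsBackwardSingularPoint V₂ 0 := isBackwardSingularPoint_congr_ae hae₂ hsing₂
  -- cubic flatness from the scar, then the ladder, then flat rigidity
  have hF3 : FarDecay 3 V₁ V₂ := stub_farFieldAllOrders V₁ V₂ Q₁ Q₂ hcl₁ hcl₂ hB₁ hB₂ hscarV
  have hall : ∀ N : ℕ, FarDecay N V₁ V₂ :=
    allOrders_of_ladder
      (fun ℓ hℓ hmom => stub_paintedLadder V₁ V₂ Q₁ Q₂ C ℓ hC hℓ hcl₁ hcl₂ hdV₁ hdV₂ hB₁ hB₂ hF3 hmom)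
      (fun hF4 => stub_quadrupoleDefectVanishes V₁ V₂ Q₁ Q₂ C hC hm₁ hm₂ hdV₁ hdV₂ hcl₁ hcl₂ hB₁ hB₂
        hsV₁ hsV₂ hF4)
      (fun ℓ hℓ hF => stub_higherMomentsVanish V₁ V₂ Q₁ Q₂ C ℓ hC hℓ hm₁ hm₂ hdV₁ hdV₂ hcl₁ hcl₂ hB₁ hB₂
        hsV₁ hsV₂ hF)
  have heq := stub_flatScarRigidity V₁ V₂ Q₁ Q₂ C hC hm₁ hm₂ hdV₁ hdV₂ hcl₁ hcl₂ hB₁ hB₂ hsV₁ hsV₂ hall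
  -- `u₁ = V₁ = V₂ = u₂` a.e. on the slab
  have hV : uncurry V₁ =ᵐ[volume.restrict (Iio (0 : ℝ) ×ˢ (univ : Set ℝ³))] uncurry V₂ :=
    ae_slab_of_forall' (P := fun z => uncurry V₁ z = uncurry V₂ z) fun t ht x => heq t ht x
  exact (hae₁.symm.trans hV).trans hae₂

/-- The crux, by name (gate shape `theorem … : <route decl>`). -/
theorem scarRigidity_momentLadder_proof : ScarRigidity := ScarRigidity_of

end Summit.NavierStokesRegularity.NavierStokesRegularity.Theorems.RellichScarScarRigidity

end
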